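import Summits.AnomalousDissipation.AnomalousDissipation.Theorems.MarginalStabilityChainStrainedLayerLawParallelRelax
import Literature.Analysis.UnboundedOperators.HeatExtensionUniformTail
import HarnessLib

/-!
# Crux `MarginalStabilityChain.StrainedLayerLaw` (stmt-AnomalousDissipation-3007), line `FirstLemmasR2K4`:
# uniform exponential tails of the strained shear diffusion (stub `stub_strainedCaloricTails`)

Support file (`--supports stmt-AnomalousDissipation-3007`; registered sub-goal `stub_strainedCaloricTails`
of line `FirstLemmasR2K4`, lead c6, wave 1). It is the pure-analysis input of the x-independent
negative `roundnessFloor_xIndependent_false` (the tails of the explicit parallel member `U_B + P` are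
verified, not assumed): for `ν > 0`, a datum `g ∈ C²_c(ℝ)` and a compact time range
`t ∈ [a, b] ⊂ (0, ∞)`, the STRAINED SHEAR DIFFUSION `P(t, y) = (e^{s(t)Δ} g)(eᵗ y)`,
`s(t) = ν (e^{2t} − 1) / 2` (Majda–Bertozzi 2002 §1.4 (1.34); `heatExtension g s = G_s ⋆ g` is the
tree's caloric extension), together with `P_y`, `P_yy` and `P_t`, is bounded by ONE profile
`C e^{−k|y|}` (`k = 1`).

Proof. Derivatives fall on the compactly supported data, `(e^{σΔ}g)' = e^{σΔ}(g')`
(`deriv_heatExtension_of_hasCompactSupport_line`), so with `σ = s(t)`, `η = eᵗ y`: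
`P_y = eᵗ (e^{σΔ}g')(η)`, `P_yy = e^{2t} (e^{σΔ}g'')(η)` and, by the chain rule along the curve
`τ ↦ (s(τ), e^τ y)` (`hasDerivAt_heatExtension_along`, heat equation inside),
`P_t = ν e^{2t} (e^{σΔ}g'')(η) + eᵗ y (e^{σΔ}g')(η)`. Each caloric extension of the `C_c` data
`g, g', g''` is bounded, uniformly for `σ ∈ [s(a), s(b)]`, by the Gaussian majorant
`norm_heatExtension_le_gaussian_of_mem_Icc` off the support and by the maximum principle
`norm_heatExtension_le` near it, hence by `C e^{−k|η|} ≤ C e^{−k|y|}` for every rate `k > 0`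
(complete the square; `|η| ≥ |y|` as `t > 0`). The factor `|y|` of `P_t` is absorbed by
`|y| e^{−2|y|} ≤ e^{−|y|}` (rate `2` for the pieces, rate `1` at the end).

No definitions, no facts asserted. References: Majda–Bertozzi 2002 §1.4 (1.34); Evans 2010 §2.3.1;
tree `Literature/Analysis/UnboundedOperators/HeatExtensionUniformTail.lean`,
`…/HeatKernelHeatEquation.lean`, `…ParallelRelaxStubCaloric.lean`, `…ParallelRelaxStubHeatGradient.lean`.
-/

set_option linter.dupNamespace false

noncomputable section

open scoped Topology ENNReal
open Filter Set Function MeasureTheory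

namespace Summit.AnomalousDissipation.AnomalousDissipation.Theorems.StrainedLayerLaw.LogEnstrophyClock

open Literature.Analysis.FluidPDE Literature.Analysis.FluidPDE.StretchedLayer
open Literature.Analysis.UnboundedOperators
open Summit.AnomalousDissipation.AnomalousDissipation.Theses.MarginalStabilityChain
open Summit.AnomalousDissipation.AnomalousDissipation.Theorems.StrainedLayerLaw.StrainWorkSumRule
open Summit.AnomalousDissipation.AnomalousDissipation.Theorems.StrainedLayerLaw.ParallelRelax

/-! File-local NOTATION (no definitions): `sclk[ν, t] = ν(e^{2t} − 1)/2` is the strain clock `s(t)`. -/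
local notation3 (prettyPrint := false) "sclk[" ν ", " t "]" => ν * (Real.exp (2 * t) - 1) / 2

/-! ## Real-variable tools -/

/-- A Gaussian lies below every exponential: `e^{-α x²} ≤ e^{k²/(4α)} e^{-k x}` for `α > 0`
(complete the square: `α x² − k x + k²/(4α) = α (x − k/(2α))² ≥ 0`). [folklore] -/
theorem strainedCaloricTails_exp_neg_mul_sq_le {α : ℝ} (hα : 0 < α) (k x : ℝ) :
    Real.exp (-α * x ^ 2) ≤ Real.exp (k ^ 2 / (4 * α)) * Real.exp (-k * x) := by
  rw [← Real.exp_add]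
  refine Real.exp_le_exp.2 ?_
  have hsq : 0 ≤ α * (x - k / (2 * α)) ^ 2 := by positivity
  have hexp : α * (x - k / (2 * α)) ^ 2 = α * x ^ 2 - k * x + k ^ 2 / (4 * α) := by
    field_simp
    ring
  linarith

/-- `|y| e^{-2|y|} ≤ e^{-|y|}` (from `|y| ≤ |y| + 1 ≤ e^{|y|}`). [folklore] -/
theorem strainedCaloricTails_abs_mul_exp_le (y : ℝ) :
    |y| * Real.exp (-2 * |y|) ≤ Real.exp (-1 * |y|) := by
  have h1 : |y| ≤ Real.exp |y| := by linarith [Real.add_one_le_exp |y|]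
  calc |y| * Real.exp (-2 * |y|) ≤ Real.exp |y| * Real.exp (-2 * |y|) :=
        mul_le_mul_of_nonneg_right h1 (Real.exp_pos _).le
    _ = Real.exp (-1 * |y|) := by rw [← Real.exp_add]; ring_nf

/-- The strain clock `s(τ) = ν (e^{2τ} − 1) / 2` has derivative `s'(t) = ν e^{2t}`. [folklore] -/
theorem strainedCaloricTails_hasDerivAt_clock (ν t : ℝ) :
    HasDerivAt (fun τ => sclk[ν, τ]) (ν * Real.exp (2 * t)) t := by
  have h1 : HasDerivAt (fun τ : ℝ => 2 * τ) 2 t := by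
    simpa using (hasDerivAt_id' t).const_mul (2 : ℝ)
  refine (((h1.exp.sub_const 1).const_mul ν).div_const 2).congr_deriv ?_
  ring

/-! ## Uniform exponential tails of the caloric extension of `C_c` data -/

/-- **Uniform exponential tails of the 1-D caloric extension of `C_c` data.** For `h : ℝ → ℝ`
continuous with compact support, heat times `s₀, s₁ > 0` and every rate `k > 0` there is `C ≥ 0`
with `|e^{σΔ}h (x)| ≤ C e^{-k|x|}` for all `σ ∈ [s₀, s₁]` and all `x`: off the support the
Gaussian majorant `(4πs₀)^{-1/2} (∫|h|) e^{-x²/(16 s₁)}` of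
`norm_heatExtension_le_gaussian_of_mem_Icc` lies below `e^{k²/(4α)} e^{-k|x|}`, `α = (16 s₁)⁻¹`;
near the support the maximum principle `|e^{σΔ}h| ≤ sup |h|` and `1 ≤ e^{2kρ} e^{-k|x|}`.
[folklore] -/
theorem strainedCaloricTails_heatExtension_le {h : ℝ → ℝ} (hh : Continuous h)
    (hhc : HasCompactSupport h) {s₀ s₁ : ℝ} (hs₀ : 0 < s₀) (hs₁ : 0 < s₁) {k : ℝ} (hk : 0 < k) :
    ∃ C : ℝ, 0 ≤ C ∧ ∀ σ ∈ Icc s₀ s₁, ∀ x : ℝ,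
      |heatExtension h σ x| ≤ C * Real.exp (-k * |x|) := by
  -- support radius, integrability and a sup bound of the data
  obtain ⟨ρ, hρ⟩ : ∃ ρ : ℝ, tsupport h ⊆ Metric.closedBall (0 : ℝ) ρ :=
    hhc.isCompact.isBounded.subset_closedBall 0
  have hsupp : ∀ z, h z ≠ 0 → ‖z‖ ≤ ρ := fun z hz =>
    mem_closedBall_zero_iff.1 (hρ (subset_tsupport h (mem_support.2 hz)))
  have hhi : Integrable h := hh.integrable_of_hasCompactSupport hhc
  obtain ⟨B, hB⟩ := hh.bounded_above_of_compact_support hhc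
  have hB0 : 0 ≤ B := (norm_nonneg _).trans (hB 0)
  -- the Gaussian majorant off the support, uniform for `σ ∈ [s₀, s₁]`
  obtain ⟨M, hM0, hgauss⟩ : ∃ M : ℝ, 0 ≤ M ∧ ∀ σ ∈ Icc s₀ s₁, ∀ x : ℝ, 2 * ρ ≤ |x| →
      |heatExtension h σ x| ≤ M * Real.exp (-(16 * s₁)⁻¹ * |x| ^ 2) := by
    refine ⟨(4 * Real.pi * s₀) ^ (-(Module.finrank ℝ ℝ : ℝ) / 2) * ∫ z, ‖h z‖, ?_,
      fun σ hσ x hx => ?_⟩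
    · exact mul_nonneg (Real.rpow_nonneg (by positivity) _)
        (integral_nonneg fun _ => norm_nonneg _)
    · have h1 := norm_heatExtension_le_gaussian_of_mem_Icc hsupp hhi hs₀ hσ (x := x)
        (by rwa [Real.norm_eq_abs])
      rwa [Real.norm_eq_abs, Real.norm_eq_abs] at h1
  have hα : 0 < (16 * s₁)⁻¹ := by positivity
  refine ⟨B * Real.exp (2 * k * ρ) + M * Real.exp (k ^ 2 / (4 * (16 * s₁)⁻¹)), by positivity,
    fun σ hσ x => ?_⟩
  have hσpos : 0 < σ := hs₀.trans_le hσ.1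
  have hBe : 0 ≤ B * Real.exp (2 * k * ρ) := by positivity
  have hMe : 0 ≤ M * Real.exp (k ^ 2 / (4 * (16 * s₁)⁻¹)) := by positivity
  rcases le_or_gt (2 * ρ) |x| with hfar | hnear
  · -- off the support: the Gaussian majorant, then complete the square
    calc |heatExtension h σ x| ≤ M * Real.exp (-(16 * s₁)⁻¹ * |x| ^ 2) := hgauss σ hσ x hfar
      _ ≤ M * (Real.exp (k ^ 2 / (4 * (16 * s₁)⁻¹)) * Real.exp (-k * |x|)) :=
          mul_le_mul_of_nonneg_left (strainedCaloricTails_exp_neg_mul_sq_le hα k |x|) hM0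
      _ = (M * Real.exp (k ^ 2 / (4 * (16 * s₁)⁻¹))) * Real.exp (-k * |x|) := by ring
      _ ≤ (B * Real.exp (2 * k * ρ) + M * Real.exp (k ^ 2 / (4 * (16 * s₁)⁻¹))) *
            Real.exp (-k * |x|) := by
          gcongr
          linarith
  · -- near the support: the maximum principle
    have h1 : |heatExtension h σ x| ≤ B := by
      have h2 := norm_heatExtension_le hB hσpos x
      rwa [Real.norm_eq_abs] at h2
    have h2 : (1 : ℝ) ≤ Real.exp (2 * k * ρ) * Real.exp (-k * |x|) := by
      rw [← Real.exp_add]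
      refine Real.one_le_exp ?_
      nlinarith
    calc |heatExtension h σ x| ≤ B := h1
      _ ≤ B * (Real.exp (2 * k * ρ) * Real.exp (-k * |x|)) := le_mul_of_one_le_right hB0 h2
      _ = (B * Real.exp (2 * k * ρ)) * Real.exp (-k * |x|) := by ring
      _ ≤ (B * Real.exp (2 * k * ρ) + M * Real.exp (k ^ 2 / (4 * (16 * s₁)⁻¹))) *
            Real.exp (-k * |x|) := by
          gcongr
          linarith

/-- **Uniform exponential tails of the strained caloric extension.** For `h ∈ C_c(ℝ)`, `ν > 0`,
`0 < a ≤ b` and `k > 0` there is `C ≥ 0` with `|(e^{s(t)Δ}h)(eᵗ y)| ≤ C e^{-k|y|}` for all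
`t ∈ [a, b]` and all `y`, `s(t) = ν (e^{2t} − 1) / 2`: the clock `s` is increasing, so
`s(t) ∈ [s(a), s(b)] ⊂ (0, ∞)`, and `|eᵗ y| ≥ |y|`. [folklore] -/
theorem strainedCaloricTails_slice_le {h : ℝ → ℝ} (hh : Continuous h) (hhc : HasCompactSupport h)
    {ν a b : ℝ} (hν : 0 < ν) (ha : 0 < a) (hab : a ≤ b) {k : ℝ} (hk : 0 < k) :
    ∃ C : ℝ, 0 ≤ C ∧ ∀ t ∈ Icc a b, ∀ y : ℝ,
      |heatExtension h sclk[ν, t] (Real.exp t * y)| ≤ C * Real.exp (-k * |y|) := by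
  obtain ⟨C, hC0, hC⟩ := strainedCaloricTails_heatExtension_le hh hhc (sclock_pos hν ha)
    (sclock_pos hν (ha.trans_le hab)) hk
  refine ⟨C, hC0, fun t ht y => ?_⟩
  have htpos : 0 < t := ha.trans_le ht.1
  have hσ : sclk[ν, t] ∈ Icc sclk[ν, a] sclk[ν, b] := by
    constructor
    · have h1 : Real.exp (2 * a) ≤ Real.exp (2 * t) := Real.exp_le_exp.2 (by linarith [ht.1])
      have h2 : ν * (Real.exp (2 * a) - 1) ≤ ν * (Real.exp (2 * t) - 1) :=
        mul_le_mul_of_nonneg_left (by linarith) hν.le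
      linarith
    · have h1 : Real.exp (2 * t) ≤ Real.exp (2 * b) := Real.exp_le_exp.2 (by linarith [ht.2])
      have h2 : ν * (Real.exp (2 * t) - 1) ≤ ν * (Real.exp (2 * b) - 1) :=
        mul_le_mul_of_nonneg_left (by linarith) hν.le
      linarith
  have hy : |y| ≤ |Real.exp t * y| := by
    rw [abs_mul, Real.abs_exp]
    have h1 : 1 ≤ Real.exp t := Real.one_le_exp htpos.le
    nlinarith [abs_nonneg y]
  calc |heatExtension h sclk[ν, t] (Real.exp t * y)|
      ≤ C * Real.exp (-k * |Real.exp t * y|) := hC _ hσ _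
    _ ≤ C * Real.exp (-k * |y|) := by
        refine mul_le_mul_of_nonneg_left (Real.exp_le_exp.2 ?_) hC0
        nlinarith

/-! ## The registered stub -/

/-- **Stub `stub_strainedCaloricTails`** (registered sub-goal of line `FirstLemmasR2K4`, wave 1 of
lead c6). For `ν > 0`, `g ∈ C²_c(ℝ)` and `0 < a ≤ b` there are `C` and `k > 0` (`k = 1`) such that
the strained shear diffusion `P(t, y) = (e^{s(t)Δ}g)(eᵗ y)`, `s(t) = ν (e^{2t} − 1) / 2`, and its
derivatives `P_y`, `P_yy`, `P_t` are bounded by `C e^{−k|y|}` for all `t ∈ [a, b]`, `y ∈ ℝ`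
(Majda–Bertozzi 2002 §1.4 (1.34): the x-independent members of the stretched class). Proof:
derivatives fall on the data (`P_y = eᵗ e^{σΔ}g'(η)`, `P_yy = e^{2t} e^{σΔ}g''(η)`,
`P_t = ν e^{2t} e^{σΔ}g''(η) + eᵗ y e^{σΔ}g'(η)`, `η = eᵗ y`, `σ = s(t)`), the uniform tails
`strainedCaloricTails_slice_le` of `e^{σΔ}h (η)` for `h = g, g', g''` at rate `2`, and
`|y| e^{−2|y|} ≤ e^{−|y|}`. [folklore] -/
theorem stub_strainedCaloricTails :
    ∀ (ν : ℝ) (g : ℝ → ℝ), 0 < ν → ContDiff ℝ 2 g → HasCompactSupport g → ∀ a b : ℝ, 0 < a → a ≤ b →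
      ∃ C k : ℝ, 0 < k ∧ ∀ t ∈ Set.Icc a b, ∀ y : ℝ,
        |heatExtension g (ν * (Real.exp (2 * t) - 1) / 2) (Real.exp t * y)| ≤ C * Real.exp (-k * |y|) ∧
        |deriv (fun s => heatExtension g (ν * (Real.exp (2 * t) - 1) / 2) (Real.exp t * s)) y| ≤
          C * Real.exp (-k * |y|) ∧
        |deriv (fun s => deriv (fun r => heatExtension g (ν * (Real.exp (2 * t) - 1) / 2) (Real.exp t * r)) s) y| ≤
          C * Real.exp (-k * |y|) ∧
        |deriv (fun τ => heatExtension g (ν * (Real.exp (2 * τ) - 1) / 2) (Real.exp τ * y)) t| ≤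
          C * Real.exp (-k * |y|) := by
  intro ν g hν hg hc a b ha hab
  -- the data and its first two derivatives are continuous with compact support
  have hg1 : ContDiff ℝ 1 g := hg.of_le one_le_two
  have hdg : ContDiff ℝ 1 (deriv g) := (show ContDiff ℝ (1 + 1) g from hg).deriv'
  have hcd : HasCompactSupport (deriv g) := hc.deriv
  have hcdd : HasCompactSupport (deriv (deriv g)) := hcd.deriv
  -- uniform tails at rate `2` of `e^{s(t)Δ} h (eᵗ y)` for `h = g, g', g''`
  obtain ⟨C₀, hC₀, h0⟩ := strainedCaloricTails_slice_le hg.continuous hc hν ha hab two_pos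
  obtain ⟨C₁, hC₁, h1⟩ := strainedCaloricTails_slice_le hdg.continuous hcd hν ha hab two_pos
  obtain ⟨C₂, hC₂, h2⟩ :=
    strainedCaloricTails_slice_le hdg.continuous_deriv_one hcdd hν ha hab two_pos
  have hx1 : 0 ≤ Real.exp b * C₁ := by positivity
  have hx2 : 0 ≤ Real.exp b * Real.exp b * C₂ := by positivity
  have hx3 : 0 ≤ ν * Real.exp (2 * b) * C₂ + Real.exp b * C₁ := by positivity
  refine ⟨C₀ + Real.exp b * C₁ + Real.exp b * Real.exp b * C₂ +
    (ν * Real.exp (2 * b) * C₂ + Real.exp b * C₁), 1, one_pos, fun t ht y => ?_⟩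
  have htpos : 0 < t := ha.trans_le ht.1
  have het : Real.exp t ≤ Real.exp b := Real.exp_le_exp.2 ht.2
  have he2t : Real.exp (2 * t) ≤ Real.exp (2 * b) := Real.exp_le_exp.2 (by linarith [ht.2])
  have hw : Real.exp (-2 * |y|) ≤ Real.exp (-1 * |y|) :=
    Real.exp_le_exp.2 (by linarith [abs_nonneg y])
  have hyw := strainedCaloricTails_abs_mul_exp_le y
  -- derivatives fall on the data
  have hD1 : ∀ σ : ℝ, deriv (heatExtension g σ) = heatExtension (deriv g) σ :=
    deriv_heatExtension_of_hasCompactSupport_line hg1 hc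
  have hD2 : ∀ σ : ℝ, deriv (deriv (heatExtension g σ)) = heatExtension (deriv (deriv g)) σ :=
    fun σ => by rw [hD1]; exact deriv_heatExtension_of_hasCompactSupport_line hdg hcd σ
  have hPy : deriv (fun s => heatExtension g sclk[ν, t] (Real.exp t * s)) y =
      Real.exp t * heatExtension (deriv g) sclk[ν, t] (Real.exp t * y) := by
    rw [deriv_comp_const_mul, hD1]
  have hPyy : deriv (fun s => deriv (fun r => heatExtension g sclk[ν, t] (Real.exp t * r)) s) y =
      Real.exp t * Real.exp t * heatExtension (deriv (deriv g)) sclk[ν, t] (Real.exp t * y) := by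
    rw [deriv_deriv_comp_const_mul, hD2]
  have hPt : deriv (fun τ => heatExtension g sclk[ν, τ] (Real.exp τ * y)) t =
      ν * Real.exp (2 * t) * heatExtension (deriv (deriv g)) sclk[ν, t] (Real.exp t * y) +
        Real.exp t * y * heatExtension (deriv g) sclk[ν, t] (Real.exp t * y) := by
    have h := hasDerivAt_heatExtension_along hg hc (strainedCaloricTails_hasDerivAt_clock ν t)
      ((Real.hasDerivAt_exp t).mul_const y) (sclock_pos hν htpos)
    rw [h.deriv, hD2, hD1]
  refine ⟨?_, ?_, ?_, ?_⟩
  · -- `P`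
    calc |heatExtension g sclk[ν, t] (Real.exp t * y)| ≤ C₀ * Real.exp (-2 * |y|) := h0 t ht y
      _ ≤ C₀ * Real.exp (-1 * |y|) := mul_le_mul_of_nonneg_left hw hC₀
      _ ≤ _ := by gcongr; linarith
  · -- `P_y = eᵗ e^{σΔ}g'(η)`
    rw [hPy, abs_mul, Real.abs_exp]
    calc Real.exp t * |heatExtension (deriv g) sclk[ν, t] (Real.exp t * y)|
        ≤ Real.exp b * (C₁ * Real.exp (-2 * |y|)) :=
          mul_le_mul het (h1 t ht y) (abs_nonneg _) (Real.exp_pos b).le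
      _ ≤ Real.exp b * (C₁ * Real.exp (-1 * |y|)) := by gcongr
      _ = Real.exp b * C₁ * Real.exp (-1 * |y|) := by ring
      _ ≤ _ := by gcongr; linarith
  · -- `P_yy = e^{2t} e^{σΔ}g''(η)`
    rw [hPyy, abs_mul, abs_mul, Real.abs_exp]
    calc Real.exp t * Real.exp t *
          |heatExtension (deriv (deriv g)) sclk[ν, t] (Real.exp t * y)|
        ≤ Real.exp b * Real.exp b * (C₂ * Real.exp (-2 * |y|)) :=
          mul_le_mul (mul_le_mul het het (Real.exp_pos t).le (Real.exp_pos b).le) (h2 t ht y)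
            (abs_nonneg _) (by positivity)
      _ ≤ Real.exp b * Real.exp b * (C₂ * Real.exp (-1 * |y|)) := by gcongr
      _ = Real.exp b * Real.exp b * C₂ * Real.exp (-1 * |y|) := by ring
      _ ≤ _ := by gcongr; linarith
  · -- `P_t = ν e^{2t} e^{σΔ}g''(η) + eᵗ y e^{σΔ}g'(η)`
    rw [hPt]
    calc |ν * Real.exp (2 * t) * heatExtension (deriv (deriv g)) sclk[ν, t] (Real.exp t * y) +
          Real.exp t * y * heatExtension (deriv g) sclk[ν, t] (Real.exp t * y)|
        ≤ |ν * Real.exp (2 * t) * heatExtension (deriv (deriv g)) sclk[ν, t] (Real.exp t * y)| +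
          |Real.exp t * y * heatExtension (deriv g) sclk[ν, t] (Real.exp t * y)| :=
          abs_add_le _ _
      _ = ν * Real.exp (2 * t) * |heatExtension (deriv (deriv g)) sclk[ν, t] (Real.exp t * y)| +
          Real.exp t * |y| * |heatExtension (deriv g) sclk[ν, t] (Real.exp t * y)| := by
          rw [abs_mul, abs_mul, abs_mul, abs_mul, abs_of_pos hν, Real.abs_exp, Real.abs_exp]
      _ ≤ ν * Real.exp (2 * b) * (C₂ * Real.exp (-2 * |y|)) +
          Real.exp b * |y| * (C₁ * Real.exp (-2 * |y|)) :=
          add_le_add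
            (mul_le_mul (mul_le_mul_of_nonneg_left he2t hν.le) (h2 t ht y) (abs_nonneg _)
              (by positivity))
            (mul_le_mul (mul_le_mul_of_nonneg_right het (abs_nonneg y)) (h1 t ht y)
              (abs_nonneg _) (by positivity))
      _ = ν * Real.exp (2 * b) * C₂ * Real.exp (-2 * |y|) +
          Real.exp b * C₁ * (|y| * Real.exp (-2 * |y|)) := by ring
      _ ≤ ν * Real.exp (2 * b) * C₂ * Real.exp (-1 * |y|) +
          Real.exp b * C₁ * Real.exp (-1 * |y|) :=
          add_le_add (mul_le_mul_of_nonneg_left hw (by positivity))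
            (mul_le_mul_of_nonneg_left hyw (by positivity))
      _ = (ν * Real.exp (2 * b) * C₂ + Real.exp b * C₁) * Real.exp (-1 * |y|) := by ring
      _ ≤ _ := mul_le_mul_of_nonneg_right (by linarith) (Real.exp_pos _).le

end Summit.AnomalousDissipation.AnomalousDissipation.Theorems.StrainedLayerLaw.LogEnstrophyClock

end
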